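import Literature.AnabelianGeometry.EtaleTheta.Discharge.Sec2Cor216OfModel
import Literature.AnabelianGeometry.EtaleTheta.Discharge.Sec2OddBijectivityOfFacts
import Literature.AnabelianGeometry.EtaleTheta.Discharge.Sec1Thm110ModelTateNV
import Literature.AnabelianGeometry.EtaleTheta.SettingModelTateThetaEnv
import HarnessLib

/-!
# [EtTh] Cor. 2.16 and Cor. 2.18 (iv) «bijection if `N/M` is odd» AT THE TATE INSTANCE
# `ThetaSetting.modelχq p 1 2` FOR THE ÉTALE-THETA DATUM OF RECORD — the Prop. 1.5 (ii), (iii) binders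
# DISCHARGED (proof-only capstone; FROZEN FACT-LIST rows F-0646, F-0647, with F-0648 riding)

Mochizuki, *The Étale Theta Function and its Frobenioid-theoretic Manifestations* [EtTh], Publ. RIMS
**45** (2009), §2: Cor. 2.16 PRIMS PDF pp. 53–54 («Profinite Non-discreteness of Bi-theta Environments»),
Cor. 2.18 (iv) pp. 61–62 («… is surjective … [hence a bijection if `N/M` is odd]»), Prop. 2.14 (iii)
p. 50; §1 Prop. 1.5 (ii), (iii) p. 23 (locators `p.N` = PDF pages of the PRIMS text; bib key
`MochizukiEtTh2009`) [cite: MochizukiEtTh2009, Cor 2.16 p.53].  Cell `abc-iut`, block F, seat abc-iut-f-153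
(gen 5; F-TRANCHES tranche 153 = F-0646 `ThetaEnvTower.Cor216` / F-0647 `ThetaEnvTower.Cor218_iv_bijective_of_odd`
/ F-0648 `ThetaEnvTower.Cor218_iv_reduction`, trunk `ThetaSystems.lean`).  PROOF-ONLY: no definition, no
instance, no notation, no new named fact; nothing of another seat is edited or restated — every input is
consumed BY NAME.

STATE OF RECORD.  The universal closures of the three rows are REFUTED at explicit toy towers (gen 0 of this
seat, `ThetaEnvTower.not_forall_cor216`, chiral tower; abc-iut-w5-d071, `not_forall_cor218_iv_bijective_of_odd`),
so the rows are consumable AT A NAMED INSTANCE only (R5).  The named instance of layer L2 is abc-iut-L2-t8's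
§1 → §2 tower `C.thetaEnvTower τ hC hS` over a theta setting `D`; there abc-iut-L2-t2 proved Cor. 2.16 modulo
Prop. 1.5 (ii), (iii) ONLY (`cor216_of_model_of_prop15`, the printed dependency via Prop. 2.14 (iii)), and gen 0
of this seat proved the odd-bijectivity clause of Cor. 2.18 (iv) modulo the L2 FACT-policy floor
(`cor218_iv_bijective_of_odd_of_model_of_facts`: Prop. 1.5 (ii)/(iii), temp-slimness of `Π^tp_X`, openness of
`Π^tp_X ↠ G_K`, Cor. 2.18 (i) at the chain levels, `ThetaEnvTower.Cor219_iii`, `IsEtThOrigin`, `hYcl`).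
abc-iut-f-150 (`Sec2Cor218Cor219AtModelChi`) and abc-iut-f-149 / abc-iut-L2-t8 (`Sec2RigidityAtModelTate`,
`SettingModelTateThetaEnv`, `SettingModelTateRigidityOfRecord(Closed)`) discharged the MODEL-SIDE binders at the
stage-1 / stage-2 records — but Cor. 2.16 appears in none of those capstones, and every stage-1 form of the
odd-bijectivity clause is VACUOUS in `h15`: at `modelχ` the typed Prop. 1.5 (iii) is refuted along the whole
section family (abc-iut-L2-t12, `not_prop15iii_etaleThetaDataχSec`).

WHY THIS FILE (honesty datum).  At the Tate instance `modelχq p 1 2` Prop. 1.5 (ii) AND (iii) are now THEOREMS for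
ONE étale-theta datum — abc-iut-w5-d171's datum of record `etaleThetaDataχqInr p` (the `inr`-section Kummer datum
carrying abc-iut-L2-t6's class `η̈♯ = etaDdχq p 1 2`; `prop15ii_etaleThetaDataχqInr`, `prop15iii_etaleThetaDataχqInr`,
`Discharge/Sec1Thm110ModelTateNV`).  Hence:

* §1 — **F-0646 Cor. 2.16 HOLDS for the model tower of the datum of record with NO `Prop` binder**
  (`cor216_modelTate_inr`: binders = the construction data `X̲̲`-choice `C` and cyclotome tower `τ` only), and
  in CLOSED form (`exists_thetaEnvTower_cor216_modelTate`): over every admissible index chain `E ∋ 1` and every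
  odd `l` there EXIST `E`, `X̲̲` (abc-iut-L2-d1's `doubleUnderlineχqOfEtaRes` + `eta_res_etaDdχq`) and `τ`
  (abc-iut-L2-t8's `modelχq_nonempty_cyclotomeTower`) whose tower of mono-theta environments satisfies Cor. 2.16 —
  the first kernel inhabitant of `ThetaEnvTower.Cor216` at a §1-model tower (the earlier positive witness was
  an abstract toy); for every `(i, j)` the form with `hC`/`hS` supplied and `h15`/`h15ii` kept is `cor216_modelχq_of_prop15`;
* §2 — **F-0647, the odd-bijectivity clause, for the datum of record modulo the two §2 RIGIDITY facts ONLY**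
  (`cor218_iv_bijective_of_odd_modelTate_inr_of_rigidity`: binders = data `C`, `τ`, a cusp labelling `L`, and
  the named facts Cor. 2.18 (i) at the chain levels + `ThetaEnvTower.Cor219_iii`; Prop. 1.5 (ii)/(iii),
  temp-slimness, `IsOpenMap aug`, `IsEtThOrigin`, `hYcl` ALL discharged) — the first instance form of F-0647 that is
  NOT vacuous in `h15`; the all-`(i, j)` form keeping `h15`/`h15ii` is `cor218_iv_bijective_of_odd_modelχq_of_facts`;
* §3 — the tranche-153 census conjunction at the datum of record (`tranche153_rows_modelTate_inr`), F-0648 riding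
  BY NAME on abc-iut-f-149's `cor218_iv_reduction_modelχq`.

HONEST LABEL: `modelχq` is a SEMI-SYNTHETIC model of the typed §1 interface (the Tate-sheared χ-twisted root; not
the tempered `π₁` of a curve) — this file is consistency / joint-satisfiability evidence for the typed rows and the
kernel record that F-0646 is a THEOREM at that inhabitant and F-0647 a theorem there modulo the two named rigidity
facts; nothing of [EtTh] (refereed) is asserted; no side is taken on [IUTchIII] Cor. 3.12; typed ≠ proved; a FACT
row is an assumption label, not an endorsement.
-/

noncomputable section

namespace Literature.AnabelianGeometry.EtaleTheta.SettingModel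

open Literature.AnabelianGeometry.SemiGraphs
open Literature.AlgebraicGeometry.Frobenioids (IsSlimGroup)

variable (p : ℕ) [Fact p.Prime]

/-! ## §1. Cor. 2.16 (F-0646) at the stage-2 record -/

section AllIndices

variable (i j : ℤ) (hj : Even j)
variable {E : (ThetaSetting.modelχq p i j hj).EtaleThetaData} {l : ℕ} (C : E.DoubleUnderline l)
  {Es : Set ℕ+} (τ : (ThetaSetting.modelχq p i j hj).CyclotomeTower l Es)

/-- **F-0646 Cor. 2.16 at the stage-2 record `modelχq p i j hj`, `hC`/`hS` SUPPLIED** (abc-iut-L2-d1's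
`modelχq_sec2Hyps`, whence `Compat`): for every étale-theta datum `E`, every `X̲̲`-choice `C` and tower `τ`, the
model tower satisfies Cor. 2.16 given Prop. 1.5 (iii), (ii) for `E` — abc-iut-L2-t2's `cor216_of_model_of_prop15`
BY NAME. [cite: MochizukiEtTh2009, Cor 2.16 p.53] -/
theorem cor216_modelχq_of_prop15
    (h15 : ThetaSetting.Prop15iii E (compat_modelχq p i j hj))
    (h15ii : ThetaSetting.Prop15ii E.toKummerData (compat_modelχq p i j hj)) :
    (C.thetaEnvTower τ (compat_modelχq p i j hj) (ThetaSetting.modelχq_sec2Hyps p i j hj)).Cor216 :=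
  C.cor216_of_model_of_prop15 τ _ _ h15 h15ii

end AllIndices

section Tate

variable {l : ℕ} (C : (etaleThetaDataχqInr p).DoubleUnderline l) {Es : Set ℕ+}
  (τ : (ThetaSetting.modelχq p 1 2 even_two).CyclotomeTower l Es)

/-- **F-0646 Cor. 2.16 HOLDS, with NO `Prop` binder, for the model tower of the étale-theta datum OF RECORD
`etaleThetaDataχqInr p` at the Tate instance `modelχq p 1 2`** ([EtTh] Cor. 2.16, p. 53: «for any `j_∞ ∈ l·Ẑ`
there is a projective system `γ_{M',M} = α ∘ β_{M',M} ∘ α'` … whose difference classes converge to the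
`j_∞`-conjugate of `η̈^Θ|_Ÿ`»): Prop. 1.5 (iii), (ii) are abc-iut-w5-d171's theorems
`prop15iii_etaleThetaDataχqInr` / `prop15ii_etaleThetaDataχqInr`; binders left = the construction data `C`, `τ`.
[cite: MochizukiEtTh2009, Cor 2.16 p.53] -/
theorem cor216_modelTate_inr :
    (C.thetaEnvTower τ (compat_modelχq p 1 2 even_two) (ThetaSetting.modelχq_sec2Hyps p 1 2 even_two)).Cor216 :=
  C.cor216_of_model_of_prop15 τ _ _ (prop15iii_etaleThetaDataχqInr p _) (prop15ii_etaleThetaDataχqInr p _)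

/-- **CLOSED FORM of F-0646 at the Tate instance**: over every admissible index chain `E ∋ 1` (cofinal, totally
ordered by divisibility) and every odd `l` there EXIST an étale-theta datum over `modelχq p 1 2` carrying the class
of record `η̈♯ = etaDdχq p 1 2`, a choice `X̲̲` for it with `Π^tp_X̲̲ = Huuχq p 1 2 l`, and a compatible cyclotome
tower, whose tower of mono-theta environments satisfies Cor. 2.16 — witnesses `etaleThetaDataχqInr p`
(abc-iut-w5-d171), `doubleUnderlineχqOfEtaRes` + `eta_res_etaDdχq` (abc-iut-L2-d1), `modelχq_nonempty_cyclotomeTower`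
(abc-iut-L2-t8). [cite: MochizukiEtTh2009, Cor 2.16 p.53] -/
theorem exists_thetaEnvTower_cor216_modelTate (l : ℕ+) (hl : Odd (l : ℕ)) (one_mem : (1 : ℕ+) ∈ Es)
    (cofinal : ∀ n : ℕ+, ∃ M ∈ Es, n ∣ M) (total : ∀ M ∈ Es, ∀ M' ∈ Es, M ∣ M' ∨ M' ∣ M) :
    ∃ (E : (ThetaSetting.modelχq p 1 2 even_two).EtaleThetaData) (C : E.DoubleUnderline l)
      (τ : (ThetaSetting.modelχq p 1 2 even_two).CyclotomeTower l Es),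
      E.etaDd = etaDdχq p 1 2 even_two ∧ C.Huu = Huuχq p 1 2 l hl ∧
        (C.thetaEnvTower τ (compat_modelχq p 1 2 even_two) (ThetaSetting.modelχq_sec2Hyps p 1 2 even_two)).Cor216 := by
  obtain ⟨τ⟩ := modelχq_nonempty_cyclotomeTower p 1 2 even_two l.pos one_mem cofinal total
  exact ⟨etaleThetaDataχqInr p,
    (etaleThetaDataχqInr p).doubleUnderlineχqOfEtaRes p 1 2 l hl (eta_res_etaDdχq p 1 2 even_two l hl), τ, rfl, rfl,
    cor216_modelTate_inr p _ τ⟩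

end Tate

/-! ## §2. Cor. 2.18 (iv), odd bijectivity (F-0647), at the stage-2 record -/

section AllIndicesOdd

variable (i j : ℤ) (hj : Even j)
variable {E : (ThetaSetting.modelχq p i j hj).EtaleThetaData} {l : ℕ} (C : E.DoubleUnderline l)
  {Es : Set ℕ+} (τ : (ThetaSetting.modelχq p i j hj).CyclotomeTower l Es)

/-- **F-0647 at the stage-2 record `modelχq p i j hj`, modulo {Prop. 1.5 (ii), (iii), Cor. 2.18 (i) at the chain
levels, `ThetaEnvTower.Cor219_iii`} and a cusp labelling** — the four model-side binders of gen 0's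
`cor218_iv_bijective_of_odd_of_model_of_facts` SUPPLIED: temp-slimness (abc-iut-f-149's `isSlimGroup_piTemp_modelχq`),
`IsOpenMap aug` (`isOpenMap_aug_modelχq`), `IsEtThOrigin` (`modelχq_isEtThOrigin`), `hYcl` (`hYcl_modelχq`, abc-iut-L2-t5).
The stage-2 twin of abc-iut-f-150's `cor218_iv_bijective_of_odd_modelχ_of_facts`. [cite: MochizukiEtTh2009, Cor 2.18(iv) p.62] -/
theorem cor218_iv_bijective_of_odd_modelχq_of_facts
    (h15 : ThetaSetting.Prop15iii E (compat_modelχq p i j hj))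
    (h15ii : ThetaSetting.Prop15ii E.toKummerData (compat_modelχq p i j hj)) (L : C.CuspLabels)
    (h218i : ∀ M : Es, (C.rigidData (τ.mod M) (compat_modelχq p i j hj)
      (ThetaSetting.modelχq_sec2Hyps p i j hj) h15 L).Cor218_i)
    (h219iii : (C.thetaEnvTower τ (compat_modelχq p i j hj) (ThetaSetting.modelχq_sec2Hyps p i j hj)).Cor219_iii) :
    (C.thetaEnvTower τ (compat_modelχq p i j hj) (ThetaSetting.modelχq_sec2Hyps p i j hj)).Cor218_iv_bijective_of_odd :=
  C.cor218_iv_bijective_of_odd_of_model_of_facts τ _ _ h15 h15ii L (isSlimGroup_piTemp_modelχq p i j hj)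
    (isOpenMap_aug_modelχq p i j hj) h218i h219iii (ThetaSetting.modelχq_isEtThOrigin p i j hj) (hYcl_modelχq p i j hj)

end AllIndicesOdd

section TateOdd

variable {l : ℕ} (C : (etaleThetaDataχqInr p).DoubleUnderline l) {Es : Set ℕ+}
  (τ : (ThetaSetting.modelχq p 1 2 even_two).CyclotomeTower l Es)

/-- **F-0647 for the datum OF RECORD at the Tate instance, modulo the two §2 RIGIDITY facts ONLY** ([EtTh]
Cor. 2.18 (iv), p. 62: «[hence is a bijection if `N/M` is odd]»): for `M ∣ M'` in the chain with `M'/M` odd,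
`Aut^μ(𝕄_{M'}) → Aut^μ(𝕄_M)` is bijective for the model tower of `etaleThetaDataχqInr p` — binders = data
`C`, `τ`, a cusp labelling `L`, Cor. 2.18 (i) at the chain levels (`h218i`), constant multiple rigidity
`ThetaEnvTower.Cor219_iii` (`h219iii`); Prop. 1.5 (ii)/(iii) are abc-iut-w5-d171's theorems, the four model-side
binders abc-iut-f-149's / abc-iut-L2-t5's. NOT vacuous in `h15`. [cite: MochizukiEtTh2009, Cor 2.18(iv) p.62] -/
theorem cor218_iv_bijective_of_odd_modelTate_inr_of_rigidity (L : C.CuspLabels)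
    (h218i : ∀ M : Es, (C.rigidData (τ.mod M) (compat_modelχq p 1 2 even_two)
      (ThetaSetting.modelχq_sec2Hyps p 1 2 even_two) (prop15iii_etaleThetaDataχqInr p _) L).Cor218_i)
    (h219iii : (C.thetaEnvTower τ (compat_modelχq p 1 2 even_two)
      (ThetaSetting.modelχq_sec2Hyps p 1 2 even_two)).Cor219_iii) :
    (C.thetaEnvTower τ (compat_modelχq p 1 2 even_two)
      (ThetaSetting.modelχq_sec2Hyps p 1 2 even_two)).Cor218_iv_bijective_of_odd :=
  cor218_iv_bijective_of_odd_modelχq_of_facts p 1 2 even_two C τ (prop15iii_etaleThetaDataχqInr p _)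
    (prop15ii_etaleThetaDataχqInr p _) L h218i h219iii

/-! ## §3. The tranche-153 census at the datum of record -/

/-- **TRANCHE 153 AT THE DATUM OF RECORD** (Tate instance `modelχq p 1 2`, étale-theta datum `etaleThetaDataχqInr p`,
every `X̲̲`-choice `C`, tower `τ`, cusp labelling `L`): F-0646 Cor. 2.16 HOLDS · F-0648 Cor. 2.18 (iv) reduction HOLDS
(abc-iut-f-149's `cor218_iv_reduction_modelχq` BY NAME) · F-0647 Cor. 2.18 (iv) odd bijectivity HOLDS modulo
Cor. 2.18 (i) at the chain levels and `ThetaEnvTower.Cor219_iii`. [cite: MochizukiEtTh2009, Cor 2.18(iv) p.61] -/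
theorem tranche153_rows_modelTate_inr (L : C.CuspLabels) :
    (C.thetaEnvTower τ (compat_modelχq p 1 2 even_two) (ThetaSetting.modelχq_sec2Hyps p 1 2 even_two)).Cor216 ∧
    (C.thetaEnvTower τ (compat_modelχq p 1 2 even_two)
      (ThetaSetting.modelχq_sec2Hyps p 1 2 even_two)).Cor218_iv_reduction ∧
    ((∀ M : Es, (C.rigidData (τ.mod M) (compat_modelχq p 1 2 even_two)
        (ThetaSetting.modelχq_sec2Hyps p 1 2 even_two) (prop15iii_etaleThetaDataχqInr p _) L).Cor218_i) →
      (C.thetaEnvTower τ (compat_modelχq p 1 2 even_two)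
        (ThetaSetting.modelχq_sec2Hyps p 1 2 even_two)).Cor219_iii →
      (C.thetaEnvTower τ (compat_modelχq p 1 2 even_two)
        (ThetaSetting.modelχq_sec2Hyps p 1 2 even_two)).Cor218_iv_bijective_of_odd) :=
  ⟨cor216_modelTate_inr p C τ, cor218_iv_reduction_modelχq p 1 2 even_two C τ _ _,
    fun h218i h219iii => cor218_iv_bijective_of_odd_modelTate_inr_of_rigidity p C τ L h218i h219iii⟩

end TateOdd

/-! ## §4. Cor. 2.19 (ii) (F-0649, tranche 154 — riding BY NAME) at the stage-2 record and at the datum of record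

(v2 append.)  [EtTh] Cor. 2.19 (ii), p. 64 («any projective system of mono-theta environments is isomorphic to the
natural one»).  abc-iut-L2-t8's `cor219_ii_modelχq_of_lift` / `thetaEnvTower_modelχqSec_cor219_ii_of_lift` keep
`h15` as a binder (K variable); abc-iut-L2-d1's `cor219_ii_model_of_facts` and abc-iut-f-150's
`exists_iso_of_systems_model_of_facts` carry the L2 FACT-policy floor.  Here: the all-`(i, j)` `_of_facts` twins with
the four model-side binders SUPPLIED, and at the datum of record `etaleThetaDataχqInr p` the forms with Prop. 1.5
(ii)/(iii) DISCHARGED — binders = data `C`, `τ`, `L` and EITHER the level-wise lifting clause of Cor. 2.18 (iv)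
(`hlift`) OR the two rigidity facts Cor. 2.18 (i) at the chain levels + `ThetaEnvTower.Cor219_iii`. -/

section AllIndicesCor219

variable (i j : ℤ) (hj : Even j)
variable {E : (ThetaSetting.modelχq p i j hj).EtaleThetaData} {l : ℕ} (C : E.DoubleUnderline l)
  {Es : Set ℕ+} (τ : (ThetaSetting.modelχq p i j hj).CyclotomeTower l Es)

/-- **F-0649 Cor. 2.19 (ii) at the stage-2 record, modulo {Prop. 1.5 (ii), (iii), Cor. 2.18 (i) at the chain levels,
`ThetaEnvTower.Cor219_iii`} and a cusp labelling** — abc-iut-L2-d1's `cor219_ii_model_of_facts` with temp-slimness,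
`IsOpenMap aug`, `IsEtThOrigin`, `hYcl` SUPPLIED (the stage-2 twin of abc-iut-f-150's `cor219_ii_modelχ_of_facts`).
[cite: MochizukiEtTh2009, Cor 2.19(ii) p.64] -/
theorem cor219_ii_modelχq_of_facts
    (h15 : ThetaSetting.Prop15iii E (compat_modelχq p i j hj))
    (h15ii : ThetaSetting.Prop15ii E.toKummerData (compat_modelχq p i j hj)) (L : C.CuspLabels)
    (h218i : ∀ M : Es, (C.rigidData (τ.mod M) (compat_modelχq p i j hj)
      (ThetaSetting.modelχq_sec2Hyps p i j hj) h15 L).Cor218_i)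
    (h219iii : (C.thetaEnvTower τ (compat_modelχq p i j hj) (ThetaSetting.modelχq_sec2Hyps p i j hj)).Cor219_iii) :
    (C.thetaEnvTower τ (compat_modelχq p i j hj) (ThetaSetting.modelχq_sec2Hyps p i j hj)).Cor219_ii :=
  C.cor219_ii_model_of_facts τ _ _ h15 h15ii L (isSlimGroup_piTemp_modelχq p i j hj)
    (isOpenMap_aug_modelχq p i j hj) h218i h219iii (ThetaSetting.modelχq_isEtThOrigin p i j hj) (hYcl_modelχq p i j hj)

/-- **Cor. 2.19 (ii), strong form (explicit isomorphism of a given system with the natural one through a chosen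
compatible cocycle family), at the stage-2 record modulo the same facts** — abc-iut-f-150's
`exists_iso_of_systems_model_of_facts` with the four model-side binders SUPPLIED. [cite: MochizukiEtTh2009, Cor 2.19(ii) p.64] -/
theorem exists_iso_of_systems_modelχq_of_facts
    (h15 : ThetaSetting.Prop15iii E (compat_modelχq p i j hj))
    (h15ii : ThetaSetting.Prop15ii E.toKummerData (compat_modelχq p i j hj)) (L : C.CuspLabels)
    (h218i : ∀ M : Es, (C.rigidData (τ.mod M) (compat_modelχq p i j hj)
      (ThetaSetting.modelχq_sec2Hyps p i j hj) h15 L).Cor218_i)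
    (h219iii : (C.thetaEnvTower τ (compat_modelχq p i j hj) (ThetaSetting.modelχq_sec2Hyps p i j hj)).Cor219_iii)
    (S : (C.thetaEnvTower τ (compat_modelχq p i j hj) (ThetaSetting.modelχq_sec2Hyps p i j hj)).MTESystem)
    (η₀ : ∀ M : Es, (C.thetaEnvTower τ (compat_modelχq p i j hj) (ThetaSetting.modelχq_sec2Hyps p i j hj)).PiYdd →
      (C.thetaEnvTower τ (compat_modelχq p i j hj) (ThetaSetting.modelχq_sec2Hyps p i j hj)).mu M)
    (hη₀ : ∀ M, η₀ M ∈ (C.thetaEnvTower τ (compat_modelχq p i j hj) (ThetaSetting.modelχq_sec2Hyps p i j hj)).thetaCocycles M)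
    (hη₀c : ∀ (M M' : Es) (h : (M : ℕ+) ∣ M'),
      (C.thetaEnvTower τ (compat_modelχq p i j hj) (ThetaSetting.modelχq_sec2Hyps p i j hj)).red M M' h ∘ η₀ M' = η₀ M) :
    ∃ α : ∀ M : Es,
        (((C.thetaEnvTower τ (compat_modelχq p i j hj) (ThetaSetting.modelχq_sec2Hyps p i j hj)).level M).modelMono
            (hη₀ M)).Iso
          (((C.thetaEnvTower τ (compat_modelχq p i j hj) (ThetaSetting.modelχq_sec2Hyps p i j hj)).level M).modelMono
            (S.mem M)),
      ∀ (M M' : Es) (h : (M : ℕ+) ∣ M')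
        (x : ((C.thetaEnvTower τ (compat_modelχq p i j hj) (ThetaSetting.modelχq_sec2Hyps p i j hj)).level M').env),
        S.a M M' h ((C.thetaEnvTower τ (compat_modelχq p i j hj) (ThetaSetting.modelχq_sec2Hyps p i j hj)).redEnv
            M M' h ((α M').e x)) =
          (α M).e ((C.thetaEnvTower τ (compat_modelχq p i j hj) (ThetaSetting.modelχq_sec2Hyps p i j hj)).redEnv
            M M' h x) :=
  C.exists_iso_of_systems_model_of_facts τ _ _ h15 h15ii L (isSlimGroup_piTemp_modelχq p i j hj)
    (isOpenMap_aug_modelχq p i j hj) h218i h219iii (ThetaSetting.modelχq_isEtThOrigin p i j hj) (hYcl_modelχq p i j hj)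
    S η₀ hη₀ hη₀c

end AllIndicesCor219

section TateCor219

variable {l : ℕ} (C : (etaleThetaDataχqInr p).DoubleUnderline l) {Es : Set ℕ+}
  (τ : (ThetaSetting.modelχq p 1 2 even_two).CyclotomeTower l Es)

/-- **F-0649 Cor. 2.19 (ii) for the datum OF RECORD at the Tate instance, modulo the level-wise lifting clause of
Cor. 2.18 (iv) ALONE** (abc-iut-f-149's `cor219_ii_modelχq_of_lift` with `h15 :=` abc-iut-w5-d171's
`prop15iii_etaleThetaDataχqInr`): binders = data `C`, `τ`, `L` and `hlift`. [cite: MochizukiEtTh2009, Cor 2.19(ii) p.64] -/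
theorem cor219_ii_modelTate_inr_of_lift (L : C.CuspLabels)
    (hlift : ∀ M : Es, (C.rigidData (τ.mod M) (compat_modelχq p 1 2 even_two)
      (ThetaSetting.modelχq_sec2Hyps p 1 2 even_two) (prop15iii_etaleThetaDataχqInr p _) L).Cor218_iv_surjective) :
    (C.thetaEnvTower τ (compat_modelχq p 1 2 even_two)
      (ThetaSetting.modelχq_sec2Hyps p 1 2 even_two)).Cor219_ii :=
  cor219_ii_modelχq_of_lift p 1 2 even_two C τ _ _ (prop15iii_etaleThetaDataχqInr p _) L hlift

/-- **F-0649 Cor. 2.19 (ii) for the datum OF RECORD at the Tate instance, modulo the two §2 RIGIDITY facts ONLY**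
(Cor. 2.18 (i) at the chain levels, `ThetaEnvTower.Cor219_iii`); Prop. 1.5 (ii)/(iii) and the four model-side
binders discharged BY NAME. NOT vacuous in `h15`. [cite: MochizukiEtTh2009, Cor 2.19(ii) p.64] -/
theorem cor219_ii_modelTate_inr_of_rigidity (L : C.CuspLabels)
    (h218i : ∀ M : Es, (C.rigidData (τ.mod M) (compat_modelχq p 1 2 even_two)
      (ThetaSetting.modelχq_sec2Hyps p 1 2 even_two) (prop15iii_etaleThetaDataχqInr p _) L).Cor218_i)
    (h219iii : (C.thetaEnvTower τ (compat_modelχq p 1 2 even_two)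
      (ThetaSetting.modelχq_sec2Hyps p 1 2 even_two)).Cor219_iii) :
    (C.thetaEnvTower τ (compat_modelχq p 1 2 even_two)
      (ThetaSetting.modelχq_sec2Hyps p 1 2 even_two)).Cor219_ii :=
  cor219_ii_modelχq_of_facts p 1 2 even_two C τ (prop15iii_etaleThetaDataχqInr p _)
    (prop15ii_etaleThetaDataχqInr p _) L h218i h219iii

/-- **TRANCHES 153 + 154 AT THE DATUM OF RECORD, modulo the two rigidity facts**: given Cor. 2.18 (i) at the chain
levels and `ThetaEnvTower.Cor219_iii` (and a cusp labelling), the model tower of `etaleThetaDataχqInr p` satisfies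
Cor. 2.16 ∧ Cor. 2.18 (iv) [reduction ∧ odd bijectivity] ∧ Cor. 2.19 (ii). [cite: MochizukiEtTh2009, Cor 2.19(ii) p.64] -/
theorem sec2_tower_rows_modelTate_inr_of_rigidity (L : C.CuspLabels)
    (h218i : ∀ M : Es, (C.rigidData (τ.mod M) (compat_modelχq p 1 2 even_two)
      (ThetaSetting.modelχq_sec2Hyps p 1 2 even_two) (prop15iii_etaleThetaDataχqInr p _) L).Cor218_i)
    (h219iii : (C.thetaEnvTower τ (compat_modelχq p 1 2 even_two)
      (ThetaSetting.modelχq_sec2Hyps p 1 2 even_two)).Cor219_iii) :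
    (C.thetaEnvTower τ (compat_modelχq p 1 2 even_two) (ThetaSetting.modelχq_sec2Hyps p 1 2 even_two)).Cor216 ∧
    (C.thetaEnvTower τ (compat_modelχq p 1 2 even_two)
      (ThetaSetting.modelχq_sec2Hyps p 1 2 even_two)).Cor218_iv_reduction ∧
    (C.thetaEnvTower τ (compat_modelχq p 1 2 even_two)
      (ThetaSetting.modelχq_sec2Hyps p 1 2 even_two)).Cor218_iv_bijective_of_odd ∧
    (C.thetaEnvTower τ (compat_modelχq p 1 2 even_two)
      (ThetaSetting.modelχq_sec2Hyps p 1 2 even_two)).Cor219_ii :=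
  ⟨cor216_modelTate_inr p C τ, cor218_iv_reduction_modelχq p 1 2 even_two C τ _ _,
    cor218_iv_bijective_of_odd_modelTate_inr_of_rigidity p C τ L h218i h219iii,
    cor219_ii_modelTate_inr_of_rigidity p C τ L h218i h219iii⟩

end TateCor219

end Literature.AnabelianGeometry.EtaleTheta.SettingModel

end
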